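import Mathlib

/-!
# Crux `RankDefectRepresentations` (stmt-PneNP-18923), line `rank-dehn-ladder`, RESHAPE 17c:
# the two-step link (`stub_twoStepLink`, brief g17 §W24)

A SIM glue is a genuine representation near a two-step almost-representation (memo g8 §6, so far only
on paper).  For colourings `α : ιA → Fin n → Bool`, `β : ιB → Fin n → Bool` put
`P_i := diagonal (1[α · i])`, `Q_i := diagonal (1[β · i])` (commuting diagonal 0/1 idempotent tuples) and let
the off-diagonal blocks `X_i : Matrix ιA ιB K` be supported on the cells whose two colours differ at `i`.
For ANY glue `Z : Matrix ιA ιB K` the conjugated tuple `E'_i := [[P_i, P_i Z − Z Q_i], [0, Q_i]]`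
(= `[[1, −Z],[0, 1]] · [[P_i, 0],[0, Q_i]] · [[1, Z],[0, 1]]`) consists of genuine commuting idempotents, and
`[[P_i, X_i],[0, Q_i]] − E'_i = [[0, X_i − (P_i Z − Z Q_i)],[0, 0]]` has rank at most (in fact exactly) the rank
of the `i`-cut error of `Z` against the sign-twisted data, i.e. of the matrix
`(a, b) ↦ if α a i ≠ β b i then X_i a b − (±Z a b) else 0` (sign `+` where `α a i` holds).
So polynomial SIM ⟹ polynomial rank-stability of the depth-2 class within its shape.
Everything is elementary block-matrix algebra over a field.
HONEST FRAMING: a calibration/bridge lemma for the Σ-SIM lane; P ≠ NP is not moved; F-N2 is a FRONTIER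
formal rung.
-/

set_option linter.dupNamespace false -- `Summit.PneNP.PneNP.…`: summit = sub-problem name (D-0017)

namespace Summit.PneNP.PneNP.Theorems.CnfIdealGenLengthRankDefectRepresentationsTwoStepLink

open Matrix

variable {K : Type} [Field K] {ιA ιB : Type}

/-- Product of two diagonal 0/1 matrices of Boolean predicates is the diagonal 0/1 matrix of their conjunction. -/
theorem diag01_mul_diag01 {ι : Type} [Fintype ι] [DecidableEq ι] (p q : ι → Bool) :
    Matrix.diagonal (fun a => if p a then (1 : K) else 0) * Matrix.diagonal (fun a => if q a then (1 : K) else 0) =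
      Matrix.diagonal (fun a => if (p a && q a) then (1 : K) else 0) := by
  rw [Matrix.diagonal_mul_diagonal]
  congr 1
  funext a
  cases p a <;> cases q a <;> simp

/-- A diagonal 0/1 matrix is idempotent. -/
theorem diag01_idem {ι : Type} [Fintype ι] [DecidableEq ι] (p : ι → Bool) :
    Matrix.diagonal (fun a => if p a then (1 : K) else 0) * Matrix.diagonal (fun a => if p a then (1 : K) else 0) =
      Matrix.diagonal (fun a => if p a then (1 : K) else 0) := by
  rw [diag01_mul_diag01]
  simp only [Bool.and_self]

/-- Diagonal 0/1 matrices commute. -/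
theorem diag01_comm {ι : Type} [Fintype ι] [DecidableEq ι] (p q : ι → Bool) :
    Matrix.diagonal (fun a => if p a then (1 : K) else 0) * Matrix.diagonal (fun a => if q a then (1 : K) else 0) =
      Matrix.diagonal (fun a => if q a then (1 : K) else 0) *
        Matrix.diagonal (fun a => if p a then (1 : K) else 0) := by
  rw [diag01_mul_diag01, diag01_mul_diag01]
  simp only [Bool.and_comm]

/-- The off-diagonal block of a product of two twisted block-triangular matrices:
`P₁ (P₂ Z − Z Q₂) + (P₁ Z − Z Q₁) Q₂ = P₁ P₂ Z − Z Q₁ Q₂` (the cross terms cancel). -/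
theorem offDiag_mul [Fintype ιA] [Fintype ιB] (P₁ P₂ : Matrix ιA ιA K) (Q₁ Q₂ : Matrix ιB ιB K)
    (Z : Matrix ιA ιB K) :
    P₁ * (P₂ * Z - Z * Q₂) + (P₁ * Z - Z * Q₁) * Q₂ = P₁ * P₂ * Z - Z * (Q₁ * Q₂) := by
  simp only [Matrix.mul_sub, Matrix.sub_mul, ← Matrix.mul_assoc]
  abel

/-- The twisted block-triangular matrix `[[P, P Z − Z Q],[0, Q]]` is idempotent when `P` and `Q` are. -/
theorem twist_idem [Fintype ιA] [Fintype ιB] (P : Matrix ιA ιA K) (Q : Matrix ιB ιB K) (Z : Matrix ιA ιB K)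
    (hP : P * P = P) (hQ : Q * Q = Q) :
    Matrix.fromBlocks P (P * Z - Z * Q) 0 Q * Matrix.fromBlocks P (P * Z - Z * Q) 0 Q =
      Matrix.fromBlocks P (P * Z - Z * Q) 0 Q := by
  rw [Matrix.fromBlocks_multiply, offDiag_mul, hP, hQ]
  simp

/-- Two twisted block-triangular matrices `[[Pₖ, Pₖ Z − Z Qₖ],[0, Qₖ]]` (same `Z`) commute when
`P₁, P₂` commute and `Q₁, Q₂` commute. -/
theorem twist_comm [Fintype ιA] [Fintype ιB] (P₁ P₂ : Matrix ιA ιA K) (Q₁ Q₂ : Matrix ιB ιB K)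
    (Z : Matrix ιA ιB K) (hP : P₁ * P₂ = P₂ * P₁) (hQ : Q₁ * Q₂ = Q₂ * Q₁) :
    Matrix.fromBlocks P₁ (P₁ * Z - Z * Q₁) 0 Q₁ * Matrix.fromBlocks P₂ (P₂ * Z - Z * Q₂) 0 Q₂ =
      Matrix.fromBlocks P₂ (P₂ * Z - Z * Q₂) 0 Q₂ * Matrix.fromBlocks P₁ (P₁ * Z - Z * Q₁) 0 Q₁ := by
  rw [Matrix.fromBlocks_multiply, Matrix.fromBlocks_multiply, offDiag_mul, offDiag_mul, hP, hQ]
  simp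

/-- Two block-triangular matrices with the same diagonal blocks differ by a corner matrix. -/
theorem fromBlocks_sub_fromBlocks_corner (A : Matrix ιA ιA K) (B B' : Matrix ιA ιB K) (D : Matrix ιB ιB K) :
    Matrix.fromBlocks A B 0 D - Matrix.fromBlocks A B' 0 D = Matrix.fromBlocks 0 (B - B') 0 0 := by
  ext (a | b) (a' | b') <;> simp

/-- The rank of a corner block matrix `[[0, B],[0, 0]]` is at most the rank of `B`
(it factors as `[1;0] · B · [0 1]`). -/
theorem rank_fromBlocks_corner_le [Fintype ιA] [Fintype ιB] [DecidableEq ιA] [DecidableEq ιB]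
    (B : Matrix ιA ιB K) :
    (Matrix.fromBlocks (0 : Matrix ιA ιA K) B 0 (0 : Matrix ιB ιB K)).rank ≤ B.rank := by
  have h : Matrix.fromBlocks (0 : Matrix ιA ιA K) B 0 (0 : Matrix ιB ιB K) =
      Matrix.fromRows (1 : Matrix ιA ιA K) (0 : Matrix ιB ιA K) * B *
        Matrix.fromCols (0 : Matrix ιB ιA K) (1 : Matrix ιB ιB K) := by
    rw [Matrix.fromRows_mul, Matrix.fromRows_mul_fromCols]
    simp
  rw [h]
  exact (Matrix.rank_mul_le_left _ _).trans (Matrix.rank_mul_le_right _ _)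

/-- The data minus the twist, entrywise: where the colours agree both vanish (the data by hypothesis),
where they differ the twist `P_i Z − Z Q_i` is `± Z`. -/
theorem data_sub_twist [Fintype ιA] [Fintype ιB] [DecidableEq ιA] [DecidableEq ιB] {n : ℕ}
    (α : ιA → Fin n → Bool) (β : ιB → Fin n → Bool)
    (X : Fin n → Matrix ιA ιB K) (Z : Matrix ιA ιB K) (i : Fin n)
    (hX : ∀ a b, α a i = β b i → X i a b = 0) :
    X i - (Matrix.diagonal (fun a => if α a i then (1 : K) else 0) * Z -
        Z * Matrix.diagonal (fun b => if β b i then (1 : K) else 0)) =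
      Matrix.of fun a b => if α a i ≠ β b i then X i a b - (if α a i then Z a b else -Z a b) else 0 := by
  ext a b
  simp only [Matrix.sub_apply, Matrix.diagonal_mul, Matrix.mul_diagonal, Matrix.of_apply]
  have h := hX a b
  revert h
  cases α a i <;> cases β b i <;> simp

/-- **The two-step link** (registered stub `stub_twoStepLink` of line `rank-dehn-ladder`, RESHAPE 17c):
for every glue `Z` the conjugated tuple `E'_i := [[P_i, P_i Z − Z Q_i],[0, Q_i]]` is a genuine commuting
idempotent tuple, and `[[P_i, X_i],[0, Q_i]] − E'_i` has rank at most the rank of the `i`-cut error of `Z`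
against the sign-twisted data. -/
theorem stub_twoStepLink :
    ∀ (K : Type) [Field K] (n : ℕ) (ιA ιB : Type) [Fintype ιA] [Fintype ιB] [DecidableEq ιA] [DecidableEq ιB]
      (α : ιA → Fin n → Bool) (β : ιB → Fin n → Bool) (X : Fin n → Matrix ιA ιB K) (Z : Matrix ιA ιB K),
      (∀ i a b, α a i = β b i → X i a b = 0) →
      ∃ E' : Fin n → Matrix (ιA ⊕ ιB) (ιA ⊕ ιB) K,
        (∀ i, E' i * E' i = E' i) ∧ (∀ i j, E' i * E' j = E' j * E' i) ∧
        ∀ i, (Matrix.fromBlocks (Matrix.diagonal fun a => if α a i then (1 : K) else 0) (X i) 0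
                (Matrix.diagonal fun b => if β b i then (1 : K) else 0) - E' i).rank ≤
          (Matrix.of fun a b => if α a i ≠ β b i then X i a b - (if α a i then Z a b else -Z a b) else 0).rank := by
  intro K _ n ιA ιB _ _ _ _ α β X Z hX
  refine ⟨fun i => Matrix.fromBlocks (Matrix.diagonal fun a => if α a i then (1 : K) else 0)
      (Matrix.diagonal (fun a => if α a i then (1 : K) else 0) * Z -
        Z * Matrix.diagonal (fun b => if β b i then (1 : K) else 0))
      0 (Matrix.diagonal fun b => if β b i then (1 : K) else 0), fun i => ?_, fun i j => ?_, fun i => ?_⟩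
  · -- idempotence
    exact twist_idem _ _ _ (diag01_idem (K := K) fun a => α a i) (diag01_idem (K := K) fun b => β b i)
  · -- commutation
    exact twist_comm _ _ _ _ _ (diag01_comm (K := K) (fun a => α a i) fun a => α a j)
      (diag01_comm (K := K) (fun b => β b i) fun b => β b j)
  · -- the difference is the corner matrix of `X i − (P_i Z − Z Q_i)`
    dsimp only
    rw [fromBlocks_sub_fromBlocks_corner]
    exact (rank_fromBlocks_corner_le _).trans (le_of_eq (by rw [data_sub_twist α β X Z i (hX i)]))

end Summit.PneNP.PneNP.Theorems.CnfIdealGenLengthRankDefectRepresentationsTwoStepLink
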